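import Mathlib
import Literature.Analysis.FluidPDE.SelfSimilarEulerSwirlingFixedPoint
import Summits.NavierStokesRegularity.NavierStokesRegularity.Theorems.EulerZoomLiouvillePowerGaugeEulerLiouvilleNeedleAxisymNoSwirlMember
import Summits.NavierStokesRegularity.NavierStokesRegularity.Theorems.EulerZoomLiouvillePowerGaugeEulerLiouvilleSelfSimilarGlobalTrajectory
import Summits.NavierStokesRegularity.NavierStokesRegularity.Theorems.EulerZoomLiouvillePowerGaugeEulerLiouvilleSelfSimilarWeakToClassical
import Summits.NavierStokesRegularity.NavierStokesRegularity.Theorems.EulerZoomLiouvillePowerGaugeEulerLiouvilleSelfSimilarPressure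
import Summits.NavierStokesRegularity.NavierStokesRegularity.Theorems.EulerZoomLiouvillePowerGaugeEulerLiouvilleSelfSimilarGauges
import Summits.NavierStokesRegularity.NavierStokesRegularity.Theorems.EulerZoomLiouvillePowerGaugeEulerLiouvilleEnergySaturationMember
import HarnessLib

/-!
# Crux E `PowerGaugeEulerLiouville` (stmt-NavierStokesRegularity-19832), THE ONE STATEMENT `stub_selfSimilarC2Needle`:
# THE SWIRL RATCHET — an axisymmetric `C²` needle carries UNBOUNDED profile swirl; bounded swirl ⇒ swirl-free ⇒ trivial
# (width seat ns-ezl-w3 g3; sequel of the unconditional (S37) `NeedleRace.selfSimilar_ae_eq_zero_of_axisymNoSwirlC2`, ns-ezl-w2 g3 p639100)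

Route №10 `EulerZoomLiouville` (NavierStokesRegularity), crux E; LEAD ns-typeII-p2 g12.  After (S37) the axisymmetric `C²` needle must SWIRL.  For an
axisymmetric self-similar Euler profile `(U, P)` of CIV (3.3) (`W = γy + U`, `P` automatically an axisymmetric scalar —
`IsSelfSimilarEulerProfile.isAxisymmetricScalar_pressure`), the polynomial swirl `Γ = swirl U = y₀U₁ − y₁U₀ = r U_θ` obeys the `θ`-component of (3.3)
(CIV, proof of Thm 4.6; Chae 2007 «Note added»: `D_t(r v^θ) = 0` in similarity variables):

  `DΓ(y)[W(y)] = −(1 − 2γ) Γ(y)`        (`SwirlRatchet.fderiv_swirl_transport`),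

so along every BACKWARD similarity orbit `Y' = −W(Y)` the swirl is RATCHETED UP, `Γ(Y(t)) = e^{(1−2γ)t} Γ(Y(0))` (`SwirlRatchet.swirl_backward_orbit`), and along
forward orbits it decays at the same rate.  With linear growth `‖U y‖ ≤ K₁(1+‖y‖)` backward orbits are global (`exists_forward_solution_of_linearGrowth` applied to `−W`),
hence, in the window `γ < ½`:

* `SwirlRatchet.hasNoSwirl_of_bounded_swirl` — **BOUNDED PROFILE SWIRL ⇒ NO SWIRL**: `sup_y |r U_θ| < ∞` forces `U_θ ≡ 0` (follow one backward orbit from a point with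
  `Γ ≠ 0`: `|Γ|` grows like `e^{(1−2γ)t}`, absurd).  Equivalently: an axisymmetric `C²` needle profile of linear growth has `sup |r U_θ| = ∞` — each physical
  time slice of the member has UNBOUNDED swirl `r u_θ`.
* MEMBER FORM `SwirlRatchet.selfSimilar_ae_eq_zero_of_axisym_boundedSwirl_C2` — crux binders verbatim (`0 < ρ ≤ ½`) + exactly self-similar ansatz (centred) + `ContDiff ℝ 2 V` +
  `IsAxisymmetric V` + linear growth + bounded profile swirl ⇒ `u = 0` a.e. ((S37) after the ratchet).  Binder for THE ONE STATEMENT: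
  `¬ (IsAxisymmetric V ∧ (∃ K₁, ∀ y, ‖V y‖ ≤ K₁ (1 + ‖y‖)) ∧ ∃ B, ∀ y, |swirl V y| ≤ B)`, widening (S37)'s `¬ (IsAxisymmetric V ∧ HasNoSwirl V)` inside the linear-growth
  model class.

In print: Chae, CMP 273 (2007) Thm 2.2 + «Note added» kills self-similar axisymmetric swirl under `r V^θ ∈ L^{p₁} ∩ L^{p₂}` (two exponents, `L^p`-scaling); the tree's
`AxisymSelfSimilarProfile.powerGaugeEulerLiouville_axisym_selfSimilar_profile` is the `L^{2k}` Casimir with `2kρ ≠ 3` for bounded profiles with bounded gradient (now inside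
`IsKinematicTameProfile`).  Here: ONE sup-norm hypothesis on the swirl, no integrability, no gradient bound — the orbitwise ratchet instead of a global Casimir.

WHAT THIS IS NOT: not NS regularity, not the crux E — one more stratum of the crux CLASS 19832 (MODEL lattice; E/NS strata) `--supports` stmt-19832; the axisymmetric
`C²` needle WITH unbounded swirl, and every non-axisymmetric needle, stay OPEN.  [cite: Chae2007CMPEuler, Thm 2.2 + Note added p. 6; ConstantinIgnatovaVicol2026Putative,
§4.4 proof of Thm 4.6 (the `U_θ` equation)]
-/

noncomputable section

-- flat `Theorems/<Route><Decl>…` files of one crux share the namespace of the crux (tree convention: `Summit.<S>.<S>.…`)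
set_option linter.dupNamespace false

open MeasureTheory Set Filter Topology Metric Function InnerProductSpace
open scoped RealInnerProductSpace NNReal ContDiff

namespace Summit.NavierStokesRegularity.NavierStokesRegularity.Theorems.PowerGaugeEulerLiouville

open Literature.Analysis Literature.Analysis.FluidPDE Literature.Analysis.FunctionSpaces

namespace SwirlRatchet

variable {γ : ℝ} {U : EuclideanSpace ℝ (Fin 3) → EuclideanSpace ℝ (Fin 3)} {P : EuclideanSpace ℝ (Fin 3) → ℝ}

/-! ### The `θ`-component of the profile equation: the swirl is an eigenfunction of the transport -/

/-- `J` is additive and homogeneous (it is the linear map `rotGenL`). [folklore] -/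
theorem rotGen_add_smul (a : ℝ) (y v : EuclideanSpace ℝ (Fin 3)) :
    rotGen (a • y + v) = a • rotGen y + rotGen v := by
  rw [← rotGenL_apply, map_add, map_smul, rotGenL_apply, rotGenL_apply]

/-- **THE SWIRL EQUATION OF A SELF-SIMILAR AXISYMMETRIC PROFILE**: `DΓ(y)[W(y)] = −(1−2γ)Γ(y)` for `Γ = swirl U = y₀U₁ − y₁U₀`, `W = γy + U`
(pair CIV (3.3) with `J y`: `⟪Jy, DU[W]⟫ = −(1−γ)Γ − ∂_θP`, `∂_θP = 0` since `P` is an axisymmetric scalar, and `⟪J W, U⟫ = γΓ`).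
[cite: ConstantinIgnatovaVicol2026Putative, §4.4 proof of Thm 4.6 (the `U_θ` equation)] -/
theorem fderiv_swirl_transport (h : IsSelfSimilarEulerProfile γ 0 U P) (hU : IsAxisymmetric U)
    (y : EuclideanSpace ℝ (Fin 3)) :
    fderiv ℝ (swirl U) y (selfSimilarTransport γ 0 U y) = -((1 - 2 * γ) * swirl U y) := by
  have hd := h.differentiable_velocity
  have hPax : IsAxisymmetricScalar P := h.isAxisymmetricScalar_pressure hU ⟨rfl, rfl⟩
  have hθP : ⟪rotGen y, gradient P y⟫ = 0 := hPax.inner_rotGen_gradient (h.differentiable_pressure y)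
  -- pair CIV (3.3) at `y` with `J y`: `⟪J y, DU[W]⟫ = −(1−γ) Γ(y)` (the pressure term drops)
  have hsw : swirl U y = ⟪rotGen y, U y⟫ := by rw [swirl_eq_inner_rotGen]
  have e := h.profile_eq y
  simp only [sub_zero] at e
  have e' := congrArg (fun v => ⟪rotGen y, v⟫) e
  simp only [inner_add_right, inner_smul_right, inner_zero_right, hθP, add_zero] at e'
  -- `⟪J W, U⟫ = γ Γ(y)`
  have hW : selfSimilarTransport γ 0 U y = γ • y + U y := by simp
  rw [hW, fderiv_swirl_apply (hd y), rotGen_add_smul, inner_add_left, inner_smul_left, inner_rotGen_self, hsw]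
  simp only [RCLike.conj_to_real, add_zero]
  linarith [e']

/-! ### The ratchet along backward similarity orbits -/

/-- **SWIRL ALONG A BACKWARD ORBIT**: if `Y' = −W(Y)` on `[0, ∞)` (right derivative at `0`), then `Γ(Y t) = Γ(Y 0) · e^{(1−2γ)t}` for `t ≥ 0`.
(`d/dt Γ(Y t) = −DΓ[W] = (1−2γ)Γ(Y t)`; the product with `e^{−(1−2γ)t}` has zero right derivative.) [cite: Chae2007CMPEuler, Thm 2.2 + Note added p. 6] -/
theorem swirl_backward_orbit (h : IsSelfSimilarEulerProfile γ 0 U P) (hU : IsAxisymmetric U)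
    {Y : ℝ → EuclideanSpace ℝ (Fin 3)}
    (hY : ∀ t, 0 ≤ t → HasDerivWithinAt Y (-(selfSimilarTransport γ 0 U (Y t))) (Ici 0) t) {t : ℝ} (ht : 0 ≤ t) :
    swirl U (Y t) = swirl U (Y 0) * Real.exp ((1 - 2 * γ) * t) := by
  have hd := h.differentiable_velocity
  -- `f(s) = Γ(Y s) e^{−(1−2γ)s}` is constant on `[0, t]`
  set f : ℝ → ℝ := fun s => swirl U (Y s) * Real.exp (-((1 - 2 * γ) * s)) with hf
  have hderΓ : ∀ s, 0 ≤ s → HasDerivWithinAt (fun s => swirl U (Y s)) ((1 - 2 * γ) * swirl U (Y s)) (Ici s) s := by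
    intro s hs
    have h1 : HasFDerivAt (swirl U) (fderiv ℝ (swirl U) (Y s)) (Y s) := (differentiableAt_swirl (hd (Y s))).hasFDerivAt
    have h2 := h1.comp_hasDerivWithinAt s ((hY s hs).mono (Ici_subset_Ici.2 hs))
    have h3 : fderiv ℝ (swirl U) (Y s) (-(selfSimilarTransport γ 0 U (Y s))) = (1 - 2 * γ) * swirl U (Y s) := by
      rw [map_neg, fderiv_swirl_transport h hU]; ring
    rw [h3] at h2
    exact h2
  have hderf : ∀ s ∈ Ico 0 t, HasDerivWithinAt f 0 (Ici s) s := by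
    intro s hs
    have he : HasDerivWithinAt (fun s => Real.exp (-((1 - 2 * γ) * s))) (Real.exp (-((1 - 2 * γ) * s)) * (-(1 - 2 * γ))) (Ici s) s := by
      have := ((hasDerivAt_id s).const_mul (1 - 2 * γ)).neg.exp
      simp only [mul_one] at this
      exact this.hasDerivWithinAt
    have hprod := (hderΓ s hs.1).mul he
    have h0 : (1 - 2 * γ) * swirl U (Y s) * Real.exp (-((1 - 2 * γ) * s)) +
        swirl U (Y s) * (Real.exp (-((1 - 2 * γ) * s)) * -(1 - 2 * γ)) = 0 := by ring
    rw [h0] at hprod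
    exact hprod
  have hcont : ContinuousOn f (Icc 0 t) := by
    have hYc : ContinuousOn Y (Icc 0 t) := fun s hs => ((hY s hs.1).continuousWithinAt).mono fun r hr => hr.1
    have hΓc : Continuous (swirl U) := (contDiff_swirl h.contDiff_velocity).continuous
    exact (hΓc.comp_continuousOn hYc).mul ((Real.continuous_exp.comp ((continuous_const.mul continuous_id).neg)).continuousOn)
  have hconst := constant_of_has_deriv_right_zero hcont hderf t (right_mem_Icc.2 ht)
  simp only [hf, mul_zero, neg_zero, Real.exp_zero, mul_one] at hconst
  -- `Γ(Y t) e^{−(1−2γ)t} = Γ(Y 0)`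
  have hexp : Real.exp (-((1 - 2 * γ) * t)) * Real.exp ((1 - 2 * γ) * t) = 1 := by
    rw [← Real.exp_add, neg_add_cancel, Real.exp_zero]
  calc swirl U (Y t) = swirl U (Y t) * (Real.exp (-((1 - 2 * γ) * t)) * Real.exp ((1 - 2 * γ) * t)) := by rw [hexp, mul_one]
    _ = swirl U (Y 0) * Real.exp ((1 - 2 * γ) * t) := by rw [← mul_assoc, hconst]

/-! ### Bounded swirl is no swirl -/

/-- **BOUNDED PROFILE SWIRL ⇒ NO SWIRL** (`γ < ½`).  `(U, P)` a `C²` self-similar Euler profile (CIV (3.3)), `U` axisymmetric of linear growth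
`‖U y‖ ≤ K₁(1+‖y‖)`, and `|swirl U| ≤ B` on `ℝ³`.  Then `U` is swirl-free.  (Through a point `y` with `Γ(y) ≠ 0` run the global backward orbit of `W`
— it exists by linear growth; along it `|Γ| = |Γ(y)| e^{(1−2γ)t} → ∞`, contradicting the bound.) [cite: Chae2007CMPEuler, Thm 2.2 + Note added p. 6] -/
theorem hasNoSwirl_of_bounded_swirl (h : IsSelfSimilarEulerProfile γ 0 U P) (hU : IsAxisymmetric U) (hγ2 : γ < 1 / 2)
    {K₁ : ℝ} (hlin : ∀ y, ‖U y‖ ≤ K₁ * (1 + ‖y‖)) {B : ℝ} (hB : ∀ y, |swirl U y| ≤ B) : HasNoSwirl U := by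
  intro y
  by_contra hne
  have hK₁ : 0 ≤ K₁ := by
    have h0 := hlin 0
    rw [norm_zero, add_zero, mul_one] at h0
    exact (norm_nonneg _).trans h0
  -- the backward field `−W` is `C¹` of linear growth
  set Wb : EuclideanSpace ℝ (Fin 3) → EuclideanSpace ℝ (Fin 3) := fun z => -(selfSimilarTransport γ 0 U z) with hWb
  have hWb1 : ContDiff ℝ 1 Wb := by
    have h1 : ContDiff ℝ 1 (selfSimilarTransport γ 0 U) :=
      PowerGaugeEulerLiouville.Kelvin.contDiff_selfSimilarTransport (h.contDiff_velocity.of_le (by norm_num))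
    exact h1.neg
  have hgrowth : ∀ z, ‖Wb z‖ ≤ (|γ| + K₁) * ‖z‖ + K₁ := by
    intro z
    rw [hWb]
    simp only [norm_neg, selfSimilarTransport_apply, sub_zero]
    calc ‖γ • z + U z‖ ≤ ‖γ • z‖ + ‖U z‖ := norm_add_le _ _
      _ ≤ |γ| * ‖z‖ + K₁ * (1 + ‖z‖) := by rw [norm_smul, Real.norm_eq_abs]; exact add_le_add le_rfl (hlin z)
      _ = (|γ| + K₁) * ‖z‖ + K₁ := by ring
  obtain ⟨Y, hY0, hY, -⟩ := Loc.exists_forward_solution_of_linearGrowth hWb1 (by positivity) hK₁ hgrowth y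
  -- the ratchet
  have hratchet : ∀ t, 0 ≤ t → swirl U (Y t) = swirl U y * Real.exp ((1 - 2 * γ) * t) := by
    intro t ht
    rw [← hY0]
    exact swirl_backward_orbit h hU (fun s hs => by simpa only [hWb] using hY s hs) ht
  -- choose `t` with `(1 − 2γ) t ≥ B / |Γ y|`
  have hpos : 0 < |swirl U y| := abs_pos.2 hne
  have h12 : 0 < 1 - 2 * γ := by linarith
  set t : ℝ := (B / |swirl U y| + 1) / (1 - 2 * γ) with htdef
  have hB0 : 0 ≤ B := (abs_nonneg _).trans (hB y)
  have ht0 : 0 ≤ t := by rw [htdef]; positivity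
  have hexp : B / |swirl U y| + 1 < Real.exp ((1 - 2 * γ) * t) := by
    have h1 : (1 - 2 * γ) * t = B / |swirl U y| + 1 := by rw [htdef]; field_simp
    rw [h1]
    linarith [Real.add_one_le_exp (B / |swirl U y| + 1)]
  have hbig : B < |swirl U (Y t)| := by
    rw [hratchet t ht0, abs_mul, abs_of_pos (Real.exp_pos _)]
    have h2 : B < |swirl U y| * (B / |swirl U y| + 1) := by
      rw [mul_add, mul_div_cancel₀ _ hpos.ne', mul_one]; linarith
    exact h2.trans (mul_lt_mul_of_pos_left hexp hpos)
  exact absurd (hB (Y t)) (not_le.2 hbig)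

/-- **AN AXISYMMETRIC `C²` NEEDLE SWIRLS WITHOUT BOUND** (contrapositive, profile level): a `C²` self-similar profile with `γ < ½`, axisymmetric, of linear growth and NOT
swirl-free has `|swirl U|` unbounded: for every `B` some `y` with `B < |y₀U₁(y) − y₁U₀(y)|`. [cite: Chae2007CMPEuler, Thm 2.2 + Note added p. 6] -/
theorem swirl_unbounded_of_not_hasNoSwirl (h : IsSelfSimilarEulerProfile γ 0 U P) (hU : IsAxisymmetric U) (hγ2 : γ < 1 / 2)
    {K₁ : ℝ} (hlin : ∀ y, ‖U y‖ ≤ K₁ * (1 + ‖y‖)) (hsw : ¬ HasNoSwirl U) (B : ℝ) :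
    ∃ y : EuclideanSpace ℝ (Fin 3), B < |swirl U y| := by
  by_contra hcon
  push Not at hcon
  exact hsw (hasNoSwirl_of_bounded_swirl h hU hγ2 hlin hcon)

end SwirlRatchet

/-! ### Member form -/

namespace SwirlRatchet

variable {u : ℝ → EuclideanSpace ℝ (Fin 3) → EuclideanSpace ℝ (Fin 3)} {p : ℝ → EuclideanSpace ℝ (Fin 3) → ℝ}
  {H : ℝ → EuclideanSpace ℝ (Fin 3) → EuclideanSpace ℝ (Fin 3) →L[ℝ] EuclideanSpace ℝ (Fin 3)} {c : ℝ≥0}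
  {V : EuclideanSpace ℝ (Fin 3) → EuclideanSpace ℝ (Fin 3)} {P : EuclideanSpace ℝ (Fin 3) → ℝ}

/-- **MEMBER FORM: AN EXACTLY SELF-SIMILAR MEMBER WITH AN AXISYMMETRIC `C²` PROFILE OF LINEAR GROWTH AND BOUNDED SWIRL IS TRIVIAL.**  Crux binders verbatim
(`0 < ρ ≤ ½`; suitable weak Euler on `(−∞,0) × ℝ³`, weak gradient `H`, gauges `≤ c`) + the exactly self-similar ansatz about the origin at the class rate
`γ = 1/(2+ρ)` + `ContDiff ℝ 2 V` + `IsAxisymmetric V` + `‖V y‖ ≤ K₁(1+‖y‖)` + `|swirl V| ≤ B` ⇒ `u = 0` a.e.  (A classical pressure `P′` exists —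
`WeakToClassical.exists_isSelfSimilarEulerProfile_of_contDiff`; the ratchet gives `HasNoSwirl V`; then the unconditional (S37)
`NeedleRace.selfSimilar_ae_eq_zero_of_axisymNoSwirlC2`.) [cite: Chae2007CMPEuler, Thm 2.2 + Note added p. 6] -/
theorem selfSimilar_ae_eq_zero_of_axisym_boundedSwirl_C2 {ρ : ℝ} (hρ : 0 < ρ) (hρ1 : ρ ≤ 1 / 2)
    (hsw : IsSuitableWeakSolutionOn (slab (EuclideanSpace ℝ (Fin 3)) (Iio 0) isOpen_Iio) 0 0 u p)
    (hH : HasWeakSpatialGradientOn (slab (EuclideanSpace ℝ (Fin 3)) (Iio 0) isOpen_Iio) u H)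
    (hgauge : ∀ a : ℝ, 0 < a →
      ENNReal.ofReal (a ^ (2 * ρ)) * cknA a (0 : ℝ × EuclideanSpace ℝ (Fin 3)) u +
          ENNReal.ofReal (a ^ ρ) * cknE a (0 : ℝ × EuclideanSpace ℝ (Fin 3)) H +
        ENNReal.ofReal (a ^ (2 * ρ)) * cknD a (0 : ℝ × EuclideanSpace ℝ (Fin 3)) p ≤ (c : ENNReal))
    (hu : ∀ τ : ℝ, τ < 0 → u τ = selfSimilarCollapse (1 / (2 + ρ)) 0 V τ)
    (hp : ∀ τ : ℝ, τ < 0 → p τ = selfSimilarCollapsePressure (1 / (2 + ρ)) 0 P τ)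
    (hV : ContDiff ℝ 2 V) (hax : IsAxisymmetric V)
    (hlin : ∃ K₁ : ℝ, ∀ y, ‖V y‖ ≤ K₁ * (1 + ‖y‖)) (hbdd : ∃ B : ℝ, ∀ y, |swirl V y| ≤ B) :
    uncurry u =ᵐ[volume.restrict (Iio (0 : ℝ) ×ˢ (univ : Set (EuclideanSpace ℝ (Fin 3))))] 0 := by
  obtain ⟨K₁, hK₁⟩ := hlin
  obtain ⟨B, hB⟩ := hbdd
  have hρ1' : ρ < 1 := by linarith
  have h2ρ : (0 : ℝ) < 2 + ρ := by linarith
  have hγ2 : 1 / (2 + ρ) < 1 / 2 := one_div_lt_one_div_of_lt two_pos (by linarith)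
  -- a classical pressure of the profile (boilerplate of the lineage's member theorems)
  have hD : ∀ a : ℝ, 0 < a → ENNReal.ofReal (a ^ (2 * ρ)) *
      cknD a (0 : ℝ × EuclideanSpace ℝ (Fin 3)) p ≤ (c : ENNReal) :=
    fun a ha => le_trans le_add_self (hgauge a ha)
  have hpm : AEStronglyMeasurable (uncurry p)
      (volume.restrict (Iio (0 : ℝ) ×ˢ (univ : Set (EuclideanSpace ℝ (Fin 3))))) := by
    have := hsw.distributional.2.2.1.aestronglyMeasurable
    simpa [slab] using this
  have hPm := aestronglyMeasurable_pressureProfile hpm hp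
  have hDprof := profile_pressure_weight_of_gaugeD hρ hρ1' hpm hp hD
  have hP1 : LocallyIntegrable P volume :=
    EnergySaturation.locallyIntegrable_pressure_of_weight hρ1' hPm
      (ENNReal.mul_ne_top ENNReal.ofReal_ne_top ENNReal.coe_ne_top) hDprof
  obtain ⟨P', hprof⟩ := WeakToClassical.exists_isSelfSimilarEulerProfile_of_contDiff hsw.distributional hu hp hV hP1
  -- the ratchet: bounded swirl ⇒ no swirl
  have hns : HasNoSwirl V := hasNoSwirl_of_bounded_swirl hprof hax hγ2 hK₁ hB
  -- (S37) unconditional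
  exact NeedleRace.selfSimilar_ae_eq_zero_of_axisymNoSwirlC2 hρ hρ1 hsw hH hgauge hu hp hV hax hns

end SwirlRatchet

end Summit.NavierStokesRegularity.NavierStokesRegularity.Theorems.PowerGaugeEulerLiouville

end
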